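import Summits.QuantumAdvantage.QuantumAdvantage.Theorems.CubicForrelationNearExactIsExactTwelveLevelSixAvoidDirs

/-!
# Crux `CubicForrelation.NearExactIsExact` (stmt-QuantumAdvantage-14043) — n = 12, level ≥ 6 AT `Φ = 936/1024`: transversal directions whose
  seven translates hit a three-coset exceptional set only FEW times (combinatorial lemma for the localisation of (H3)/(H4))

Certificate seat `b2b-cforr-cert` (gen 18).  HONEST FRAMING: a purely combinatorial lemma (standard axioms) about cosets of a 512-element
xor-closed `V₀ ⊂ 𝔽₂¹²`, feeding the (H3)/(H4) localisation for the RIGID level-`≥ 6` configurations at `Σ e² = 704`; NOT summit progress.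
`tw18_dirs_few_hits`: `S = x_Z ⊕ V₀`; three further cosets `yᵢ ⊕ V₀` (pairwise distinct, all `≠ S`) contain a finite "bad" set `Ω`.  For every
parametrised `k`-flat inside `S` there are directions `t₁, t₂, t₃` such that all seven translates of the flat by the non-zero elements of
`⟨t₁, t₂, t₃⟩` lie OFF `S`, and `512·#{(parameter, translate) landing in Ω} ≤ 2^k·#Ω` — by AVERAGING: `t₁ ∈ x_Z ⊕ y₁ ⊕ V₀`, `t₂ ∈ x_Z ⊕ y₂ ⊕ V₀`
sweep the cosets of `y₁`, `y₂` uniformly; a dependent third coset `x_Z ⊕ y₁ ⊕ y₂ ⊕ V₀` is swept by the `t₁ ⊕ t₂` translate (`t₃` generic,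
`fl1_avoid`), an independent one by `t₃ ∈ x_Z ⊕ y₃ ⊕ V₀`; the mixed translates land in bad-point-free cosets.  (Gen 15's `tw15_avoid_dirs`: two
cosets with `≤ 31` bad points, count `0`; at `936/1024` cosets with `32` bad points and triples of bad cosets occur.)
References: MacWilliams–Sloane (1977) Ch. 13 §3.  Everything below is proved from Mathlib and the tree; axioms are the standard three.
-/

set_option linter.dupNamespace false -- D-0017: single-problem summit ⇒ `QuantumAdvantage.QuantumAdvantage` by design

noncomputable section

namespace Summit.QuantumAdvantage.QuantumAdvantage.Theorems.CubicForrelation.NearExactIsExact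

open Finset
open Literature.Computability.QuantumComplexity
open Literature.Computability.QuantumComplexity.BuzetChailloux (bxor zeroVec bxor_bxor_cancel_left bxor_zeroVec zeroVec_bxor bxor_comm
  bxor_self)

/-! ### Few hits by averaging -/

/-- **Transversal directions with few hits in a three-coset exceptional set.**  See the module docstring: all `7·2^k` translate points lie
off `S`, and `512·#{(ε, translate) landing in Ω} ≤ 2^k·#Ω`. [this work] -/
theorem tw18_dirs_few_hits (V₀ S Ω : Finset (Fin (6 + 6) → Bool)) (xZ y₁ y₂ y₃ : Fin (6 + 6) → Bool) (h0 : zeroVec ∈ V₀)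
    (hadd : ∀ a ∈ V₀, ∀ b ∈ V₀, bxor a b ∈ V₀) (hcardV : #V₀ = 512) (hS : S = V₀.image (bxor xZ))
    (hy₁ : y₁ ∉ S) (hy₂ : y₂ ∉ S) (hy₃ : y₃ ∉ S) (hy₁₂ : y₂ ∉ V₀.image (bxor y₁))
    (hy₁₃ : y₃ ∉ V₀.image (bxor y₁)) (hy₂₃ : y₃ ∉ V₀.image (bxor y₂))
    (hΩ : ∀ ω ∈ Ω, ω ∈ V₀.image (bxor y₁) ∨ ω ∈ V₀.image (bxor y₂) ∨ ω ∈ V₀.image (bxor y₃))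
    {k : ℕ} (x : Fin (6 + 6) → Bool) (hx : x ∈ S) (a : Fin k → Fin (6 + 6) → Bool) (ha : ∀ i, a i ∈ V₀) :
    ∃ t₁ t₂ t₃ : Fin (6 + 6) → Bool,
      (∀ ε : Fin k → Bool,
        bxor (fun j => x j ^^ decide (Odd #(univ.filter fun i => ε i && a i j))) t₁ ∉ S ∧
        bxor (fun j => x j ^^ decide (Odd #(univ.filter fun i => ε i && a i j))) t₂ ∉ S ∧
        bxor (bxor (fun j => x j ^^ decide (Odd #(univ.filter fun i => ε i && a i j))) t₂) t₁ ∉ S ∧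
        bxor (fun j => x j ^^ decide (Odd #(univ.filter fun i => ε i && a i j))) t₃ ∉ S ∧
        bxor (bxor (fun j => x j ^^ decide (Odd #(univ.filter fun i => ε i && a i j))) t₃) t₁ ∉ S ∧
        bxor (bxor (fun j => x j ^^ decide (Odd #(univ.filter fun i => ε i && a i j))) t₃) t₂ ∉ S ∧
        bxor (bxor (bxor (fun j => x j ^^ decide (Odd #(univ.filter fun i => ε i && a i j))) t₃) t₂) t₁ ∉ S) ∧
      512 * ∑ ε : Fin k → Bool,
        ((if bxor (fun j => x j ^^ decide (Odd #(univ.filter fun i => ε i && a i j))) t₁ ∈ Ω then 1 else 0) +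
         (if bxor (fun j => x j ^^ decide (Odd #(univ.filter fun i => ε i && a i j))) t₂ ∈ Ω then 1 else 0) +
         (if bxor (bxor (fun j => x j ^^ decide (Odd #(univ.filter fun i => ε i && a i j))) t₂) t₁ ∈ Ω then 1 else 0) +
         (if bxor (fun j => x j ^^ decide (Odd #(univ.filter fun i => ε i && a i j))) t₃ ∈ Ω then 1 else 0) +
         (if bxor (bxor (fun j => x j ^^ decide (Odd #(univ.filter fun i => ε i && a i j))) t₃) t₁ ∈ Ω then 1 else 0) +
         (if bxor (bxor (fun j => x j ^^ decide (Odd #(univ.filter fun i => ε i && a i j))) t₃) t₂ ∈ Ω then 1 else 0) +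
         (if bxor (bxor (bxor (fun j => x j ^^ decide (Odd #(univ.filter fun i => ε i && a i j))) t₃) t₂) t₁ ∈ Ω then 1 else 0))
        ≤ 2 ^ k * #Ω := by
  classical
  set pt : (Fin k → Bool) → (Fin (6 + 6) → Bool) := fun ε => fun j => x j ^^ decide (Odd #(univ.filter fun i => ε i && a i j))
  have hPV : ∀ x, x ∈ S → ∀ a ∈ V₀, bxor x a ∈ S := fun x hx a ha => fl1_coset_vadd hadd hS hx ha
  have hpt : ∀ ε, pt ε ∈ S := fun ε => ws_flatPt_mem V₀ h0 (· ∈ S) hPV k x hx a ha ε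
  -- membership criteria
  have hmemV : ∀ c q : Fin (6 + 6) → Bool, q ∈ V₀.image (bxor c) ↔ bxor c q ∈ V₀ := fun c q =>
    ⟨fun h => by obtain ⟨v, hv, hvq⟩ := mem_image.1 h; rw [← hvq, bxor_bxor_cancel_left]; exact hv,
      fun h => mem_image.2 ⟨bxor c q, h, bxor_bxor_cancel_left c q⟩⟩
  have hmemS : ∀ q, q ∈ S ↔ bxor xZ q ∈ V₀ := fun q => by rw [hS]; exact hmemV xZ q
  -- class algebra modulo `V₀`
  have hsymm : ∀ p q, bxor p q ∈ V₀ → bxor q p ∈ V₀ := fun p q h => by rw [bxor_comm]; exact h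
  have htrans : ∀ p q r, bxor p q ∈ V₀ → bxor q r ∈ V₀ → bxor p r ∈ V₀ := by
    intro p q r h1 h2
    have e : bxor p r = bxor (bxor p q) (bxor q r) := by funext j; simp only [bxor]; cases p j <;> cases q j <;> cases r j <;> rfl
    rw [e]; exact hadd _ h1 _ h2
  have hcomb : ∀ c d p q, bxor c p ∈ V₀ → bxor d q ∈ V₀ → bxor (bxor c d) (bxor p q) ∈ V₀ := by
    intro c d p q h1 h2
    have e : bxor (bxor c d) (bxor p q) = bxor (bxor c p) (bxor d q) := by funext j; simp only [bxor]; cases c j <;> cases d j <;> cases p j <;> cases q j <;> rfl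
    rw [e]; exact hadd _ h1 _ h2
  have hcls : ∀ c R q, bxor R q ∈ V₀ → (q ∈ V₀.image (bxor c) ↔ bxor c R ∈ V₀) := by
    intro c R q hRq
    rw [hmemV]
    exact ⟨fun h => htrans c q R h (hsymm R q hRq), fun h => htrans c R q h hRq⟩
  have hclsS : ∀ R q, bxor R q ∈ V₀ → (q ∈ S ↔ bxor xZ R ∈ V₀) := fun R q h => by rw [hS]; exact hcls xZ R q h
  -- basic non-memberships
  have n₁ : bxor xZ y₁ ∉ V₀ := fun h => hy₁ ((hmemS y₁).2 h)
  have n₂ : bxor xZ y₂ ∉ V₀ := fun h => hy₂ ((hmemS y₂).2 h)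
  have n₃ : bxor xZ y₃ ∉ V₀ := fun h => hy₃ ((hmemS y₃).2 h)
  have n₁₂ : bxor y₁ y₂ ∉ V₀ := fun h => hy₁₂ ((hmemV y₁ y₂).2 h)
  have n₁₃ : bxor y₁ y₃ ∉ V₀ := fun h => hy₁₃ ((hmemV y₁ y₃).2 h)
  have n₂₃ : bxor y₂ y₃ ∉ V₀ := fun h => hy₂₃ ((hmemV y₂ y₃).2 h)
  -- flat points are in the class of `xZ`
  have cp : ∀ ε, bxor xZ (pt ε) ∈ V₀ := fun ε => (hmemS _).1 (hpt ε)
  -- the three bad cosets and the exceptional counts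
  set C₁ := V₀.image (bxor y₁); set C₂ := V₀.image (bxor y₂); set C₃ := V₀.image (bxor y₃)
  have hΩout : ∀ q, q ∉ C₁ → q ∉ C₂ → q ∉ C₃ → q ∉ Ω := fun q h1 h2 h3 hq => by
    rcases hΩ q hq with h | h | h
    exacts [h1 h, h2 h, h3 h]
  have hn : #(Ω.filter fun ω => ω ∈ C₁) + #(Ω.filter fun ω => ω ∈ C₂) + #(Ω.filter fun ω => ω ∈ C₃) ≤ #Ω := by
    have hmem1 : ∀ ω, ω ∈ C₁ → bxor y₁ ω ∈ V₀ := fun ω h => (hmemV y₁ ω).1 h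
    have hmem2 : ∀ ω, ω ∈ C₂ → bxor y₂ ω ∈ V₀ := fun ω h => (hmemV y₂ ω).1 h; have hmem3 : ∀ ω, ω ∈ C₃ → bxor y₃ ω ∈ V₀ := fun ω h => (hmemV y₃ ω).1 h
    have d12 : Disjoint (Ω.filter fun ω => ω ∈ C₁) (Ω.filter fun ω => ω ∈ C₂) := by
      rw [disjoint_left]
      intro ω h1 h2
      exact n₁₂ (htrans y₁ ω y₂ (hmem1 ω (mem_filter.1 h1).2) (hsymm _ _ (hmem2 ω (mem_filter.1 h2).2)))
    have d123 : Disjoint ((Ω.filter fun ω => ω ∈ C₁) ∪ (Ω.filter fun ω => ω ∈ C₂)) (Ω.filter fun ω => ω ∈ C₃) := by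
      rw [disjoint_left]
      intro ω h12 h3
      rcases mem_union.1 h12 with h1 | h2
      · exact n₁₃ (htrans y₁ ω y₃ (hmem1 ω (mem_filter.1 h1).2) (hsymm _ _ (hmem3 ω (mem_filter.1 h3).2)))
      · exact n₂₃ (htrans y₂ ω y₃ (hmem2 ω (mem_filter.1 h2).2) (hsymm _ _ (hmem3 ω (mem_filter.1 h3).2)))
    rw [← card_union_of_disjoint d12, ← card_union_of_disjoint d123]
    exact card_le_card (union_subset (union_subset (filter_subset _ _) (filter_subset _ _)) (filter_subset _ _))
  -- counting along a coset: the translates of the flat points by `t ∈ D` that land in `Ω`, when they all lie in the coset `C`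
  have hcnt : ∀ (D C : Finset (Fin (6 + 6) → Bool)) (q : Fin (6 + 6) → Bool), (∀ t ∈ D, bxor q t ∈ C) →
      #(D.filter fun t => bxor q t ∈ Ω) ≤ #(Ω.filter fun ω => ω ∈ C) := by
    intro D C q hq
    refine Finset.card_le_card_of_injOn (bxor q) (fun t ht => ?_) (fun t _ t' _ h => ?_)
    · have ht' := mem_filter.1 (Finset.mem_coe.1 ht)
      exact Finset.mem_coe.2 (mem_filter.2 ⟨ht'.2, hq t ht'.1⟩)
    · have := congrArg (bxor q) h
      rwa [bxor_bxor_cancel_left, bxor_bxor_cancel_left] at this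
  have hsum_cnt : ∀ (D C : Finset (Fin (6 + 6) → Bool)) (q : (Fin k → Bool) → (Fin (6 + 6) → Bool)),
      (∀ ε, ∀ t ∈ D, bxor (q ε) t ∈ C) →
      ∑ t ∈ D, ∑ ε : Fin k → Bool, (if bxor (q ε) t ∈ Ω then 1 else 0) ≤ 2 ^ k * #(Ω.filter fun ω => ω ∈ C) := by
    intro D C q hq
    rw [sum_comm]
    calc ∑ ε : Fin k → Bool, ∑ t ∈ D, (if bxor (q ε) t ∈ Ω then 1 else 0)
        = ∑ ε : Fin k → Bool, #(D.filter fun t => bxor (q ε) t ∈ Ω) := sum_congr rfl fun ε _ => by rw [sum_boole]; rfl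
      _ ≤ ∑ ε : Fin k → Bool, #(Ω.filter fun ω => ω ∈ C) := sum_le_sum fun ε _ => hcnt D C (q ε) (hq ε)
      _ = 2 ^ k * #(Ω.filter fun ω => ω ∈ C) := by
          rw [sum_const, card_univ, Fintype.card_fun, Fintype.card_bool, Fintype.card_fin, smul_eq_mul]
  -- averaging on a 512-element set
  have havg : ∀ (D : Finset (Fin (6 + 6) → Bool)) (F : (Fin (6 + 6) → Bool) → ℕ) (M : ℕ), #D = 512 →
      ∑ t ∈ D, F t ≤ M → ∃ t ∈ D, 512 * F t ≤ M := by
    intro D F M hD hsum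
    by_contra hno; push Not at hno
    have hne : D.Nonempty := card_pos.1 (by rw [hD]; norm_num)
    have hlt := sum_lt_sum_of_nonempty hne hno
    rw [sum_const, hD, smul_eq_mul, ← mul_sum] at hlt
    have : 512 * ∑ t ∈ D, F t ≤ 512 * M := Nat.mul_le_mul_left _ hsum
    omega
  -- the cosets `D_i = (xZ ⊕ y_i) ⊕ V₀` from which `t₁, t₂` (and `t₃`) are drawn
  set D₁ := V₀.image (bxor (bxor xZ y₁)); set D₂ := V₀.image (bxor (bxor xZ y₂)); set D₃ := V₀.image (bxor (bxor xZ y₃))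
  have hDcard : ∀ z : Fin (6 + 6) → Bool, #(V₀.image (bxor z)) = 512 := fun z => by
    rw [card_image_of_injective _ (fun a b h => by simpa using congrArg (bxor z) h), hcardV]
  have hDcls : ∀ (z t : Fin (6 + 6) → Bool), t ∈ V₀.image (bxor z) → bxor z t ∈ V₀ := fun z t ht => (hmemV z t).1 ht
  -- class representatives of the `t₁`-, `t₂`- and `t₂ ⊕ t₁`-translates (common to both cases)
  have cT1 : ∀ t₁ ∈ D₁, ∀ ε, bxor (bxor xZ (bxor xZ y₁)) (bxor (pt ε) t₁) ∈ V₀ :=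
    fun t₁ ht₁ ε => hcomb xZ (bxor xZ y₁) (pt ε) t₁ (cp ε) (hDcls _ _ ht₁)
  have cT2 : ∀ t₂ ∈ D₂, ∀ ε, bxor (bxor xZ (bxor xZ y₂)) (bxor (pt ε) t₂) ∈ V₀ :=
    fun t₂ ht₂ ε => hcomb xZ (bxor xZ y₂) (pt ε) t₂ (cp ε) (hDcls _ _ ht₂)
  have cT3 : ∀ t₁ ∈ D₁, ∀ t₂ ∈ D₂, ∀ ε, bxor (bxor (bxor xZ (bxor xZ y₂)) (bxor xZ y₁)) (bxor (bxor (pt ε) t₂) t₁) ∈ V₀ :=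
    fun t₁ ht₁ t₂ ht₂ ε => hcomb (bxor xZ (bxor xZ y₂)) (bxor xZ y₁) (bxor (pt ε) t₂) t₁ (cT2 t₂ ht₂ ε) (hDcls _ _ ht₁)
  -- Boolean identities for the representatives
  have eS1 : bxor xZ (bxor xZ (bxor xZ y₁)) = bxor xZ y₁ := bxor_bxor_cancel_left _ _
  have eS2 : bxor xZ (bxor xZ (bxor xZ y₂)) = bxor xZ y₂ := bxor_bxor_cancel_left _ _
  have eS3 : bxor xZ (bxor (bxor xZ (bxor xZ y₂)) (bxor xZ y₁)) = bxor y₁ y₂ := by funext j; simp only [bxor]; cases xZ j <;> cases y₁ j <;> cases y₂ j <;> rfl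
  have eC11 : bxor y₁ (bxor xZ (bxor xZ y₁)) = zeroVec := by funext j; simp only [bxor, zeroVec]; cases xZ j <;> cases y₁ j <;> rfl
  have eC22 : bxor y₂ (bxor xZ (bxor xZ y₂)) = zeroVec := by funext j; simp only [bxor, zeroVec]; cases xZ j <;> cases y₂ j <;> rfl
  have eC13 : bxor y₁ (bxor (bxor xZ (bxor xZ y₂)) (bxor xZ y₁)) = bxor xZ y₂ := by funext j; simp only [bxor]; cases xZ j <;> cases y₁ j <;> cases y₂ j <;> rfl
  have eC23 : bxor y₂ (bxor (bxor xZ (bxor xZ y₂)) (bxor xZ y₁)) = bxor xZ y₁ := by funext j; simp only [bxor]; cases xZ j <;> cases y₁ j <;> cases y₂ j <;> rfl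
  -- facts about the `t₁`-, `t₂`-, `t₂ ⊕ t₁`-translates
  have hT1S : ∀ t₁ ∈ D₁, ∀ ε, bxor (pt ε) t₁ ∉ S := fun t₁ ht₁ ε h =>
    n₁ (by have := (hclsS _ _ (cT1 t₁ ht₁ ε)).1 h; rwa [eS1] at this)
  have hT2S : ∀ t₂ ∈ D₂, ∀ ε, bxor (pt ε) t₂ ∉ S := fun t₂ ht₂ ε h =>
    n₂ (by have := (hclsS _ _ (cT2 t₂ ht₂ ε)).1 h; rwa [eS2] at this)
  have hT3S : ∀ t₁ ∈ D₁, ∀ t₂ ∈ D₂, ∀ ε, bxor (bxor (pt ε) t₂) t₁ ∉ S := fun t₁ ht₁ t₂ ht₂ ε h =>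
    n₁₂ (by have := (hclsS _ _ (cT3 t₁ ht₁ t₂ ht₂ ε)).1 h; rwa [eS3] at this)
  have hT1C : ∀ t₁ ∈ D₁, ∀ ε, bxor (pt ε) t₁ ∈ C₁ := fun t₁ ht₁ ε =>
    (hcls y₁ _ _ (cT1 t₁ ht₁ ε)).2 (by rw [eC11]; exact h0)
  have hT2C : ∀ t₂ ∈ D₂, ∀ ε, bxor (pt ε) t₂ ∈ C₂ := fun t₂ ht₂ ε =>
    (hcls y₂ _ _ (cT2 t₂ ht₂ ε)).2 (by rw [eC22]; exact h0)
  have hT3C1 : ∀ t₁ ∈ D₁, ∀ t₂ ∈ D₂, ∀ ε, bxor (bxor (pt ε) t₂) t₁ ∉ C₁ := fun t₁ ht₁ t₂ ht₂ ε h =>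
    n₂ (by have := (hcls y₁ _ _ (cT3 t₁ ht₁ t₂ ht₂ ε)).1 h; rwa [eC13] at this)
  have hT3C2 : ∀ t₁ ∈ D₁, ∀ t₂ ∈ D₂, ∀ ε, bxor (bxor (pt ε) t₂) t₁ ∉ C₂ := fun t₁ ht₁ t₂ ht₂ ε h =>
    n₁ (by have := (hcls y₂ _ _ (cT3 t₁ ht₁ t₂ ht₂ ε)).1 h; rwa [eC23] at this)
  -- sums of the `t₁`- and `t₂`-hit counts over the cosets
  have hsum1 : ∑ t ∈ D₁, ∑ ε : Fin k → Bool, (if bxor (pt ε) t ∈ Ω then 1 else 0) ≤ 2 ^ k * #(Ω.filter fun ω => ω ∈ C₁) :=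
    hsum_cnt D₁ C₁ pt fun ε t ht => hT1C t ht ε
  have hsum2 : ∑ t ∈ D₂, ∑ ε : Fin k → Bool, (if bxor (pt ε) t ∈ Ω then 1 else 0) ≤ 2 ^ k * #(Ω.filter fun ω => ω ∈ C₂) :=
    hsum_cnt D₂ C₂ pt fun ε t ht => hT2C t ht ε
  by_cases hdep : bxor (bxor (bxor xZ y₁) y₂) y₃ ∈ V₀
  · /- DEPENDENT third coset `y₃ ⊕ V₀ = xZ ⊕ y₁ ⊕ y₂ ⊕ V₀`: it is swept by the `t₂ ⊕ t₁` translate; `t₃` generic -/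
    have hC3 : ∀ R q, bxor R q ∈ V₀ → (q ∈ C₃ ↔ bxor (bxor (bxor xZ y₁) y₂) R ∈ V₀) := by
      intro R q hRq
      rw [hcls y₃ R q hRq]
      exact ⟨fun h => htrans _ y₃ R hdep h, fun h => htrans y₃ _ R (hsymm _ _ hdep) h⟩
    have eC33 : bxor (bxor (bxor xZ y₁) y₂) (bxor (bxor xZ (bxor xZ y₂)) (bxor xZ y₁)) = zeroVec := by
      funext j; simp only [bxor, zeroVec]; cases xZ j <;> cases y₁ j <;> cases y₂ j <;> rfl
    have hT3C : ∀ t₁ ∈ D₁, ∀ t₂ ∈ D₂, ∀ ε, bxor (bxor (pt ε) t₂) t₁ ∈ C₃ := fun t₁ ht₁ t₂ ht₂ ε =>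
      (hC3 _ _ (cT3 t₁ ht₁ t₂ ht₂ ε)).2 (by rw [eC33]; exact h0)
    -- the generic direction `d` outside `V₀, (xZ⊕y₁)⊕V₀, (xZ⊕y₂)⊕V₀, (y₁⊕y₂)⊕V₀`
    obtain ⟨d, -, hd⟩ := fl1_avoid univ V₀ [zeroVec, bxor xZ y₁, bxor xZ y₂, bxor y₁ y₂] (by
      rw [hcardV, card_univ, Fintype.card_fun, Fintype.card_bool, Fintype.card_fin]; norm_num)
    have hd0 : bxor d d ∈ V₀ := by rw [bxor_self]; exact h0
    have hdV : d ∉ V₀ := by have h := hd zeroVec (by simp); rwa [zeroVec_bxor] at h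
    have hd1 : bxor (bxor xZ y₁) d ∉ V₀ := hd _ (by simp)
    have hd2 : bxor (bxor xZ y₂) d ∉ V₀ := hd _ (by simp)
    have hd12 : bxor (bxor y₁ y₂) d ∉ V₀ := hd _ (by simp)
    -- class representatives of the `d`-translates
    have cT4 : ∀ ε, bxor (bxor xZ d) (bxor (pt ε) d) ∈ V₀ := fun ε => hcomb xZ d (pt ε) d (cp ε) hd0
    have cT5 : ∀ t₁ ∈ D₁, ∀ ε, bxor (bxor (bxor xZ d) (bxor xZ y₁)) (bxor (bxor (pt ε) d) t₁) ∈ V₀ :=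
      fun t₁ ht₁ ε => hcomb (bxor xZ d) (bxor xZ y₁) (bxor (pt ε) d) t₁ (cT4 ε) (hDcls _ _ ht₁)
    have cT6 : ∀ t₂ ∈ D₂, ∀ ε, bxor (bxor (bxor xZ d) (bxor xZ y₂)) (bxor (bxor (pt ε) d) t₂) ∈ V₀ :=
      fun t₂ ht₂ ε => hcomb (bxor xZ d) (bxor xZ y₂) (bxor (pt ε) d) t₂ (cT4 ε) (hDcls _ _ ht₂)
    have cT7 : ∀ t₁ ∈ D₁, ∀ t₂ ∈ D₂, ∀ ε,
        bxor (bxor (bxor (bxor xZ d) (bxor xZ y₂)) (bxor xZ y₁)) (bxor (bxor (bxor (pt ε) d) t₂) t₁) ∈ V₀ :=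
      fun t₁ ht₁ t₂ ht₂ ε => hcomb (bxor (bxor xZ d) (bxor xZ y₂)) (bxor xZ y₁) (bxor (bxor (pt ε) d) t₂) t₁ (cT6 t₂ ht₂ ε)
        (hDcls _ _ ht₁)
    -- identities: `S`-tests
    have eS4 : bxor xZ (bxor xZ d) = d := bxor_bxor_cancel_left _ _
    have eS5 : bxor xZ (bxor (bxor xZ d) (bxor xZ y₁)) = bxor (bxor xZ y₁) d := by funext j; simp only [bxor]; cases xZ j <;> cases y₁ j <;> cases d j <;> rfl
    have eS6 : bxor xZ (bxor (bxor xZ d) (bxor xZ y₂)) = bxor (bxor xZ y₂) d := by funext j; simp only [bxor]; cases xZ j <;> cases y₂ j <;> cases d j <;> rfl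
    have eS7 : bxor xZ (bxor (bxor (bxor xZ d) (bxor xZ y₂)) (bxor xZ y₁)) = bxor (bxor y₁ y₂) d := by
      funext j; simp only [bxor]; cases xZ j <;> cases y₁ j <;> cases y₂ j <;> cases d j <;> rfl
    -- identities: `C₁`-tests
    have e14 : bxor y₁ (bxor xZ d) = bxor (bxor xZ y₁) d := by funext j; simp only [bxor]; cases xZ j <;> cases y₁ j <;> cases d j <;> rfl
    have e15 : bxor y₁ (bxor (bxor xZ d) (bxor xZ y₁)) = d := by funext j; simp only [bxor]; cases xZ j <;> cases y₁ j <;> cases d j <;> rfl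
    have e16 : bxor y₁ (bxor (bxor xZ d) (bxor xZ y₂)) = bxor (bxor y₁ y₂) d := by funext j; simp only [bxor]; cases xZ j <;> cases y₁ j <;> cases y₂ j <;> cases d j <;> rfl
    have e17 : bxor y₁ (bxor (bxor (bxor xZ d) (bxor xZ y₂)) (bxor xZ y₁)) = bxor (bxor xZ y₂) d := by
      funext j; simp only [bxor]; cases xZ j <;> cases y₁ j <;> cases y₂ j <;> cases d j <;> rfl
    -- identities: `C₂`-tests
    have e24 : bxor y₂ (bxor xZ d) = bxor (bxor xZ y₂) d := by funext j; simp only [bxor]; cases xZ j <;> cases y₂ j <;> cases d j <;> rfl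
    have e25 : bxor y₂ (bxor (bxor xZ d) (bxor xZ y₁)) = bxor (bxor y₁ y₂) d := by funext j; simp only [bxor]; cases xZ j <;> cases y₁ j <;> cases y₂ j <;> cases d j <;> rfl
    have e26 : bxor y₂ (bxor (bxor xZ d) (bxor xZ y₂)) = d := by funext j; simp only [bxor]; cases xZ j <;> cases y₂ j <;> cases d j <;> rfl
    have e27 : bxor y₂ (bxor (bxor (bxor xZ d) (bxor xZ y₂)) (bxor xZ y₁)) = bxor (bxor xZ y₁) d := by
      funext j; simp only [bxor]; cases xZ j <;> cases y₁ j <;> cases y₂ j <;> cases d j <;> rfl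
    -- identities: `C₃`-tests (against the representative `xZ ⊕ y₁ ⊕ y₂` of `y₃`)
    have e34 : bxor (bxor (bxor xZ y₁) y₂) (bxor xZ d) = bxor (bxor y₁ y₂) d := by funext j; simp only [bxor]; cases xZ j <;> cases y₁ j <;> cases y₂ j <;> cases d j <;> rfl
    have e35 : bxor (bxor (bxor xZ y₁) y₂) (bxor (bxor xZ d) (bxor xZ y₁)) = bxor (bxor xZ y₂) d := by
      funext j; simp only [bxor]; cases xZ j <;> cases y₁ j <;> cases y₂ j <;> cases d j <;> rfl
    have e36 : bxor (bxor (bxor xZ y₁) y₂) (bxor (bxor xZ d) (bxor xZ y₂)) = bxor (bxor xZ y₁) d := by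
      funext j; simp only [bxor]; cases xZ j <;> cases y₁ j <;> cases y₂ j <;> cases d j <;> rfl
    have e37 : bxor (bxor (bxor xZ y₁) y₂) (bxor (bxor (bxor xZ d) (bxor xZ y₂)) (bxor xZ y₁)) = d := by
      funext j; simp only [bxor]; cases xZ j <;> cases y₁ j <;> cases y₂ j <;> cases d j <;> rfl
    -- the `d`-translates are off `S` and off `Ω`
    have hT4S : ∀ ε, bxor (pt ε) d ∉ S := fun ε h => hdV (by have := (hclsS _ _ (cT4 ε)).1 h; rwa [eS4] at this)
    have hT5S : ∀ t₁ ∈ D₁, ∀ ε, bxor (bxor (pt ε) d) t₁ ∉ S := fun t₁ ht₁ ε h =>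
      hd1 (by have := (hclsS _ _ (cT5 t₁ ht₁ ε)).1 h; rwa [eS5] at this)
    have hT6S : ∀ t₂ ∈ D₂, ∀ ε, bxor (bxor (pt ε) d) t₂ ∉ S := fun t₂ ht₂ ε h =>
      hd2 (by have := (hclsS _ _ (cT6 t₂ ht₂ ε)).1 h; rwa [eS6] at this)
    have hT7S : ∀ t₁ ∈ D₁, ∀ t₂ ∈ D₂, ∀ ε, bxor (bxor (bxor (pt ε) d) t₂) t₁ ∉ S := fun t₁ ht₁ t₂ ht₂ ε h =>
      hd12 (by have := (hclsS _ _ (cT7 t₁ ht₁ t₂ ht₂ ε)).1 h; rwa [eS7] at this)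
    have hT4Ω : ∀ ε, bxor (pt ε) d ∉ Ω := fun ε =>
      hΩout _ (fun h => hd1 (by have := (hcls y₁ _ _ (cT4 ε)).1 h; rwa [e14] at this))
        (fun h => hd2 (by have := (hcls y₂ _ _ (cT4 ε)).1 h; rwa [e24] at this))
        (fun h => hd12 (by have := (hC3 _ _ (cT4 ε)).1 h; rwa [e34] at this))
    have hT5Ω : ∀ t₁ ∈ D₁, ∀ ε, bxor (bxor (pt ε) d) t₁ ∉ Ω := fun t₁ ht₁ ε =>
      hΩout _ (fun h => hdV (by have := (hcls y₁ _ _ (cT5 t₁ ht₁ ε)).1 h; rwa [e15] at this))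
        (fun h => hd12 (by have := (hcls y₂ _ _ (cT5 t₁ ht₁ ε)).1 h; rwa [e25] at this))
        (fun h => hd2 (by have := (hC3 _ _ (cT5 t₁ ht₁ ε)).1 h; rwa [e35] at this))
    have hT6Ω : ∀ t₂ ∈ D₂, ∀ ε, bxor (bxor (pt ε) d) t₂ ∉ Ω := fun t₂ ht₂ ε =>
      hΩout _ (fun h => hd12 (by have := (hcls y₁ _ _ (cT6 t₂ ht₂ ε)).1 h; rwa [e16] at this))
        (fun h => hdV (by have := (hcls y₂ _ _ (cT6 t₂ ht₂ ε)).1 h; rwa [e26] at this))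
        (fun h => hd1 (by have := (hC3 _ _ (cT6 t₂ ht₂ ε)).1 h; rwa [e36] at this))
    have hT7Ω : ∀ t₁ ∈ D₁, ∀ t₂ ∈ D₂, ∀ ε, bxor (bxor (bxor (pt ε) d) t₂) t₁ ∉ Ω := fun t₁ ht₁ t₂ ht₂ ε =>
      hΩout _ (fun h => hd2 (by have := (hcls y₁ _ _ (cT7 t₁ ht₁ t₂ ht₂ ε)).1 h; rwa [e17] at this))
        (fun h => hd1 (by have := (hcls y₂ _ _ (cT7 t₁ ht₁ t₂ ht₂ ε)).1 h; rwa [e27] at this))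
        (fun h => hdV (by have := (hC3 _ _ (cT7 t₁ ht₁ t₂ ht₂ ε)).1 h; rwa [e37] at this))
    -- the `t₂ ⊕ t₁` hit count, swept by `t₂` for each fixed `t₁`
    have hsum3 : ∀ t₁ ∈ D₁, ∑ t ∈ D₂, ∑ ε : Fin k → Bool, (if bxor (bxor (pt ε) t) t₁ ∈ Ω then 1 else 0) ≤
        2 ^ k * #(Ω.filter fun ω => ω ∈ C₃) := by
      intro t₁ ht₁
      have e : ∀ t ε, bxor (bxor (pt ε) t) t₁ = bxor (bxor (pt ε) t₁) t := fun t ε => by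
        funext j; simp only [bxor]; cases pt ε j <;> cases t j <;> cases t₁ j <;> rfl
      simp_rw [e]
      refine hsum_cnt D₂ C₃ (fun ε => bxor (pt ε) t₁) fun ε t ht => ?_
      rw [← e t ε]
      exact hT3C t₁ ht₁ t ht ε
    -- averaging over `t₁`, then over `t₂`
    set M := 2 ^ k * (#(Ω.filter fun ω => ω ∈ C₁) + #(Ω.filter fun ω => ω ∈ C₂) + #(Ω.filter fun ω => ω ∈ C₃)) with hM
    set G : (Fin (6 + 6) → Bool) → ℕ := fun t₁ => ∑ t₂ ∈ D₂, ∑ ε : Fin k → Bool,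
      ((if bxor (pt ε) t₁ ∈ Ω then 1 else 0) + (if bxor (pt ε) t₂ ∈ Ω then 1 else 0) +
        (if bxor (bxor (pt ε) t₂) t₁ ∈ Ω then 1 else 0)) with hG
    have hGsum : ∑ t₁ ∈ D₁, G t₁ ≤ 512 * M := by
      have e : ∀ t₁, G t₁ = 512 * ∑ ε : Fin k → Bool, (if bxor (pt ε) t₁ ∈ Ω then 1 else 0) +
          ∑ t₂ ∈ D₂, ∑ ε : Fin k → Bool, (if bxor (pt ε) t₂ ∈ Ω then 1 else 0) +
          ∑ t₂ ∈ D₂, ∑ ε : Fin k → Bool, (if bxor (bxor (pt ε) t₂) t₁ ∈ Ω then 1 else 0) := by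
        intro t₁
        simp only [G, sum_add_distrib]
        rw [sum_const, hDcard, smul_eq_mul]
      rw [sum_congr rfl fun t₁ _ => e t₁, sum_add_distrib, sum_add_distrib, ← mul_sum, sum_const, hDcard, smul_eq_mul]
      have h3 : ∑ t₁ ∈ D₁, ∑ t₂ ∈ D₂, ∑ ε : Fin k → Bool, (if bxor (bxor (pt ε) t₂) t₁ ∈ Ω then 1 else 0) ≤
          512 * (2 ^ k * #(Ω.filter fun ω => ω ∈ C₃)) := by
        calc ∑ t₁ ∈ D₁, ∑ t₂ ∈ D₂, ∑ ε : Fin k → Bool, (if bxor (bxor (pt ε) t₂) t₁ ∈ Ω then 1 else 0)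
            ≤ ∑ t₁ ∈ D₁, 2 ^ k * #(Ω.filter fun ω => ω ∈ C₃) := sum_le_sum fun t₁ ht₁ => hsum3 t₁ ht₁
          _ = 512 * (2 ^ k * #(Ω.filter fun ω => ω ∈ C₃)) := by rw [sum_const, hDcard, smul_eq_mul]
      simp only [M]
      nlinarith [hsum1, hsum2, h3]
    obtain ⟨t₁, ht₁, hGt₁⟩ := havg D₁ G (512 * M) (hDcard _) hGsum
    have hGle : G t₁ ≤ M := by omega
    obtain ⟨t₂, ht₂, hH⟩ := havg D₂ _ M (hDcard _) hGle
    refine ⟨t₁, t₂, d, fun ε => ⟨hT1S t₁ ht₁ ε, hT2S t₂ ht₂ ε, hT3S t₁ ht₁ t₂ ht₂ ε, hT4S ε, hT5S t₁ ht₁ ε, hT6S t₂ ht₂ ε,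
      hT7S t₁ ht₁ t₂ ht₂ ε⟩, ?_⟩
    have e : ∀ ε : Fin k → Bool,
        ((if bxor (pt ε) t₁ ∈ Ω then 1 else 0) + (if bxor (pt ε) t₂ ∈ Ω then 1 else 0) +
          (if bxor (bxor (pt ε) t₂) t₁ ∈ Ω then 1 else 0) + (if bxor (pt ε) d ∈ Ω then 1 else 0) +
          (if bxor (bxor (pt ε) d) t₁ ∈ Ω then 1 else 0) + (if bxor (bxor (pt ε) d) t₂ ∈ Ω then 1 else 0) +
          (if bxor (bxor (bxor (pt ε) d) t₂) t₁ ∈ Ω then 1 else 0) : ℕ) =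
        (if bxor (pt ε) t₁ ∈ Ω then 1 else 0) + (if bxor (pt ε) t₂ ∈ Ω then 1 else 0) +
          (if bxor (bxor (pt ε) t₂) t₁ ∈ Ω then 1 else 0) := by
      intro ε
      rw [if_neg (hT4Ω ε), if_neg (hT5Ω t₁ ht₁ ε), if_neg (hT6Ω t₂ ht₂ ε), if_neg (hT7Ω t₁ ht₁ t₂ ht₂ ε)]
      simp only [add_zero]
    rw [sum_congr rfl fun ε _ => e ε]
    calc 512 * ∑ ε : Fin k → Bool, ((if bxor (pt ε) t₁ ∈ Ω then 1 else 0) + (if bxor (pt ε) t₂ ∈ Ω then 1 else 0) +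
          (if bxor (bxor (pt ε) t₂) t₁ ∈ Ω then 1 else 0)) ≤ M := hH
      _ ≤ 2 ^ k * #Ω := by simp only [M]; exact Nat.mul_le_mul_left _ hn
  · /- INDEPENDENT third coset: `t₃ ∈ (xZ ⊕ y₃) ⊕ V₀` sweeps it; the mixed translates land in bad-point-free cosets -/
    have hind : bxor (bxor (bxor xZ y₁) y₂) y₃ ∉ V₀ := hdep
    -- class representatives of the `t₃`-translates
    have cT4 : ∀ t₃ ∈ D₃, ∀ ε, bxor (bxor xZ (bxor xZ y₃)) (bxor (pt ε) t₃) ∈ V₀ :=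
      fun t₃ ht₃ ε => hcomb xZ (bxor xZ y₃) (pt ε) t₃ (cp ε) (hDcls _ _ ht₃)
    have cT5 : ∀ t₁ ∈ D₁, ∀ t₃ ∈ D₃, ∀ ε, bxor (bxor (bxor xZ (bxor xZ y₃)) (bxor xZ y₁)) (bxor (bxor (pt ε) t₃) t₁) ∈ V₀ :=
      fun t₁ ht₁ t₃ ht₃ ε => hcomb (bxor xZ (bxor xZ y₃)) (bxor xZ y₁) (bxor (pt ε) t₃) t₁ (cT4 t₃ ht₃ ε) (hDcls _ _ ht₁)
    have cT6 : ∀ t₂ ∈ D₂, ∀ t₃ ∈ D₃, ∀ ε, bxor (bxor (bxor xZ (bxor xZ y₃)) (bxor xZ y₂)) (bxor (bxor (pt ε) t₃) t₂) ∈ V₀ :=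
      fun t₂ ht₂ t₃ ht₃ ε => hcomb (bxor xZ (bxor xZ y₃)) (bxor xZ y₂) (bxor (pt ε) t₃) t₂ (cT4 t₃ ht₃ ε) (hDcls _ _ ht₂)
    have cT7 : ∀ t₁ ∈ D₁, ∀ t₂ ∈ D₂, ∀ t₃ ∈ D₃, ∀ ε,
        bxor (bxor (bxor (bxor xZ (bxor xZ y₃)) (bxor xZ y₂)) (bxor xZ y₁)) (bxor (bxor (bxor (pt ε) t₃) t₂) t₁) ∈ V₀ :=
      fun t₁ ht₁ t₂ ht₂ t₃ ht₃ ε => hcomb (bxor (bxor xZ (bxor xZ y₃)) (bxor xZ y₂)) (bxor xZ y₁) (bxor (bxor (pt ε) t₃) t₂) t₁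
        (cT6 t₂ ht₂ t₃ ht₃ ε) (hDcls _ _ ht₁)
    -- identities: `S`-tests
    have eS4 : bxor xZ (bxor xZ (bxor xZ y₃)) = bxor xZ y₃ := bxor_bxor_cancel_left _ _
    have eS5 : bxor xZ (bxor (bxor xZ (bxor xZ y₃)) (bxor xZ y₁)) = bxor y₁ y₃ := by funext j; simp only [bxor]; cases xZ j <;> cases y₁ j <;> cases y₃ j <;> rfl
    have eS6 : bxor xZ (bxor (bxor xZ (bxor xZ y₃)) (bxor xZ y₂)) = bxor y₂ y₃ := by funext j; simp only [bxor]; cases xZ j <;> cases y₂ j <;> cases y₃ j <;> rfl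
    have eS7 : bxor xZ (bxor (bxor (bxor xZ (bxor xZ y₃)) (bxor xZ y₂)) (bxor xZ y₁)) = bxor (bxor (bxor xZ y₁) y₂) y₃ := by
      funext j; simp only [bxor]; cases xZ j <;> cases y₁ j <;> cases y₂ j <;> cases y₃ j <;> rfl
    -- identities: `C₁`-tests (translates 3, 5, 6, 7; `eC13` above)
    have e15 : bxor y₁ (bxor (bxor xZ (bxor xZ y₃)) (bxor xZ y₁)) = bxor xZ y₃ := by funext j; simp only [bxor]; cases xZ j <;> cases y₁ j <;> cases y₃ j <;> rfl
    have e16 : bxor y₁ (bxor (bxor xZ (bxor xZ y₃)) (bxor xZ y₂)) = bxor (bxor (bxor xZ y₁) y₂) y₃ := by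
      funext j; simp only [bxor]; cases xZ j <;> cases y₁ j <;> cases y₂ j <;> cases y₃ j <;> rfl
    have e17 : bxor y₁ (bxor (bxor (bxor xZ (bxor xZ y₃)) (bxor xZ y₂)) (bxor xZ y₁)) = bxor y₂ y₃ := by
      funext j; simp only [bxor]; cases xZ j <;> cases y₁ j <;> cases y₂ j <;> cases y₃ j <;> rfl
    -- identities: `C₂`-tests (`eC23` above)
    have e25 : bxor y₂ (bxor (bxor xZ (bxor xZ y₃)) (bxor xZ y₁)) = bxor (bxor (bxor xZ y₁) y₂) y₃ := by
      funext j; simp only [bxor]; cases xZ j <;> cases y₁ j <;> cases y₂ j <;> cases y₃ j <;> rfl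
    have e26 : bxor y₂ (bxor (bxor xZ (bxor xZ y₃)) (bxor xZ y₂)) = bxor xZ y₃ := by funext j; simp only [bxor]; cases xZ j <;> cases y₂ j <;> cases y₃ j <;> rfl
    have e27 : bxor y₂ (bxor (bxor (bxor xZ (bxor xZ y₃)) (bxor xZ y₂)) (bxor xZ y₁)) = bxor y₁ y₃ := by
      funext j; simp only [bxor]; cases xZ j <;> cases y₁ j <;> cases y₂ j <;> cases y₃ j <;> rfl
    -- identities: `C₃`-tests
    have e33 : bxor y₃ (bxor (bxor xZ (bxor xZ y₂)) (bxor xZ y₁)) = bxor (bxor (bxor xZ y₁) y₂) y₃ := by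
      funext j; simp only [bxor]; cases xZ j <;> cases y₁ j <;> cases y₂ j <;> cases y₃ j <;> rfl
    have e34 : bxor y₃ (bxor xZ (bxor xZ y₃)) = zeroVec := by funext j; simp only [bxor, zeroVec]; cases xZ j <;> cases y₃ j <;> rfl
    have e35 : bxor y₃ (bxor (bxor xZ (bxor xZ y₃)) (bxor xZ y₁)) = bxor xZ y₁ := by funext j; simp only [bxor]; cases xZ j <;> cases y₁ j <;> cases y₃ j <;> rfl
    have e36 : bxor y₃ (bxor (bxor xZ (bxor xZ y₃)) (bxor xZ y₂)) = bxor xZ y₂ := by funext j; simp only [bxor]; cases xZ j <;> cases y₂ j <;> cases y₃ j <;> rfl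
    have e37 : bxor y₃ (bxor (bxor (bxor xZ (bxor xZ y₃)) (bxor xZ y₂)) (bxor xZ y₁)) = bxor y₁ y₂ := by
      funext j; simp only [bxor]; cases xZ j <;> cases y₁ j <;> cases y₂ j <;> cases y₃ j <;> rfl
    -- off `S`
    have hT4S : ∀ t₃ ∈ D₃, ∀ ε, bxor (pt ε) t₃ ∉ S := fun t₃ ht₃ ε h =>
      n₃ (by have := (hclsS _ _ (cT4 t₃ ht₃ ε)).1 h; rwa [eS4] at this)
    have hT5S : ∀ t₁ ∈ D₁, ∀ t₃ ∈ D₃, ∀ ε, bxor (bxor (pt ε) t₃) t₁ ∉ S := fun t₁ ht₁ t₃ ht₃ ε h =>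
      n₁₃ (by have := (hclsS _ _ (cT5 t₁ ht₁ t₃ ht₃ ε)).1 h; rwa [eS5] at this)
    have hT6S : ∀ t₂ ∈ D₂, ∀ t₃ ∈ D₃, ∀ ε, bxor (bxor (pt ε) t₃) t₂ ∉ S := fun t₂ ht₂ t₃ ht₃ ε h =>
      n₂₃ (by have := (hclsS _ _ (cT6 t₂ ht₂ t₃ ht₃ ε)).1 h; rwa [eS6] at this)
    have hT7S : ∀ t₁ ∈ D₁, ∀ t₂ ∈ D₂, ∀ t₃ ∈ D₃, ∀ ε, bxor (bxor (bxor (pt ε) t₃) t₂) t₁ ∉ S :=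
      fun t₁ ht₁ t₂ ht₂ t₃ ht₃ ε h => hind (by have := (hclsS _ _ (cT7 t₁ ht₁ t₂ ht₂ t₃ ht₃ ε)).1 h; rwa [eS7] at this)
    -- the `t₃`-translate lies in `C₃`; the mixed translates avoid `Ω`
    have hT4C : ∀ t₃ ∈ D₃, ∀ ε, bxor (pt ε) t₃ ∈ C₃ := fun t₃ ht₃ ε =>
      (hcls y₃ _ _ (cT4 t₃ ht₃ ε)).2 (by rw [e34]; exact h0)
    have hT3Ω : ∀ t₁ ∈ D₁, ∀ t₂ ∈ D₂, ∀ ε, bxor (bxor (pt ε) t₂) t₁ ∉ Ω := fun t₁ ht₁ t₂ ht₂ ε =>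
      hΩout _ (hT3C1 t₁ ht₁ t₂ ht₂ ε) (hT3C2 t₁ ht₁ t₂ ht₂ ε)
        (fun h => hind (by have := (hcls y₃ _ _ (cT3 t₁ ht₁ t₂ ht₂ ε)).1 h; rwa [e33] at this))
    have hT5Ω : ∀ t₁ ∈ D₁, ∀ t₃ ∈ D₃, ∀ ε, bxor (bxor (pt ε) t₃) t₁ ∉ Ω := fun t₁ ht₁ t₃ ht₃ ε =>
      hΩout _ (fun h => n₃ (by have := (hcls y₁ _ _ (cT5 t₁ ht₁ t₃ ht₃ ε)).1 h; rwa [e15] at this))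
        (fun h => hind (by have := (hcls y₂ _ _ (cT5 t₁ ht₁ t₃ ht₃ ε)).1 h; rwa [e25] at this))
        (fun h => n₁ (by have := (hcls y₃ _ _ (cT5 t₁ ht₁ t₃ ht₃ ε)).1 h; rwa [e35] at this))
    have hT6Ω : ∀ t₂ ∈ D₂, ∀ t₃ ∈ D₃, ∀ ε, bxor (bxor (pt ε) t₃) t₂ ∉ Ω := fun t₂ ht₂ t₃ ht₃ ε =>
      hΩout _ (fun h => hind (by have := (hcls y₁ _ _ (cT6 t₂ ht₂ t₃ ht₃ ε)).1 h; rwa [e16] at this))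
        (fun h => n₃ (by have := (hcls y₂ _ _ (cT6 t₂ ht₂ t₃ ht₃ ε)).1 h; rwa [e26] at this))
        (fun h => n₂ (by have := (hcls y₃ _ _ (cT6 t₂ ht₂ t₃ ht₃ ε)).1 h; rwa [e36] at this))
    have hT7Ω : ∀ t₁ ∈ D₁, ∀ t₂ ∈ D₂, ∀ t₃ ∈ D₃, ∀ ε, bxor (bxor (bxor (pt ε) t₃) t₂) t₁ ∉ Ω :=
      fun t₁ ht₁ t₂ ht₂ t₃ ht₃ ε =>
      hΩout _ (fun h => n₂₃ (by have := (hcls y₁ _ _ (cT7 t₁ ht₁ t₂ ht₂ t₃ ht₃ ε)).1 h; rwa [e17] at this))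
        (fun h => n₁₃ (by have := (hcls y₂ _ _ (cT7 t₁ ht₁ t₂ ht₂ t₃ ht₃ ε)).1 h; rwa [e27] at this))
        (fun h => n₁₂ (by have := (hcls y₃ _ _ (cT7 t₁ ht₁ t₂ ht₂ t₃ ht₃ ε)).1 h; rwa [e37] at this))
    -- the `t₃`-hit count
    have hsum4 : ∑ t ∈ D₃, ∑ ε : Fin k → Bool, (if bxor (pt ε) t ∈ Ω then 1 else 0) ≤ 2 ^ k * #(Ω.filter fun ω => ω ∈ C₃) :=
      hsum_cnt D₃ C₃ pt fun ε t ht => hT4C t ht ε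
    -- three independent averagings
    obtain ⟨t₁, ht₁, h1⟩ := havg D₁ _ _ (hDcard _) hsum1
    obtain ⟨t₂, ht₂, h2⟩ := havg D₂ _ _ (hDcard _) hsum2
    obtain ⟨t₃, ht₃, h4⟩ := havg D₃ _ _ (hDcard _) hsum4
    refine ⟨t₁, t₂, t₃, fun ε => ⟨hT1S t₁ ht₁ ε, hT2S t₂ ht₂ ε, hT3S t₁ ht₁ t₂ ht₂ ε, hT4S t₃ ht₃ ε, hT5S t₁ ht₁ t₃ ht₃ ε,
      hT6S t₂ ht₂ t₃ ht₃ ε, hT7S t₁ ht₁ t₂ ht₂ t₃ ht₃ ε⟩, ?_⟩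
    have e : ∀ ε : Fin k → Bool,
        ((if bxor (pt ε) t₁ ∈ Ω then 1 else 0) + (if bxor (pt ε) t₂ ∈ Ω then 1 else 0) +
          (if bxor (bxor (pt ε) t₂) t₁ ∈ Ω then 1 else 0) + (if bxor (pt ε) t₃ ∈ Ω then 1 else 0) +
          (if bxor (bxor (pt ε) t₃) t₁ ∈ Ω then 1 else 0) + (if bxor (bxor (pt ε) t₃) t₂ ∈ Ω then 1 else 0) +
          (if bxor (bxor (bxor (pt ε) t₃) t₂) t₁ ∈ Ω then 1 else 0) : ℕ) =
        (if bxor (pt ε) t₁ ∈ Ω then 1 else 0) + (if bxor (pt ε) t₂ ∈ Ω then 1 else 0) +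
          (if bxor (pt ε) t₃ ∈ Ω then 1 else 0) := by
      intro ε
      rw [if_neg (hT3Ω t₁ ht₁ t₂ ht₂ ε), if_neg (hT5Ω t₁ ht₁ t₃ ht₃ ε), if_neg (hT6Ω t₂ ht₂ t₃ ht₃ ε),
        if_neg (hT7Ω t₁ ht₁ t₂ ht₂ t₃ ht₃ ε)]
      simp only [add_zero]
    rw [sum_congr rfl fun ε _ => e ε, sum_add_distrib, sum_add_distrib]
    have hn' := Nat.mul_le_mul_left (2 ^ k) hn
    nlinarith [h1, h2, h4, hn']

end Summit.QuantumAdvantage.QuantumAdvantage.Theorems.CubicForrelation.NearExactIsExact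

end
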